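import Mathlib.GroupTheory.Perm.List
import Mathlib.GroupTheory.Perm.Fin
import Mathlib.Algebra.Group.Pointwise.Finset.Basic
import Literature.Combinatorics.Additive.TripleProductProperty
import HarnessLib

/-!
# `β(2^{1+4}_+) ≥ 64 = 2|G|`: a `(4,4,4)` TPP triple in the extraspecial group of order 32 (plus type)

ω-census, family (b3) 'new objects'.  Framing: lottery ticket; floor = certified bounds/negative ranges.

The extraspecial group `2^{1+4}_+ = D₈ ∘ D₈` (central product; SmallGroup(32,49)) is realised as a group of
permutations of `Fin 8` (its faithful action on the `8` cosets of an elementary abelian subgroup of order `4` meeting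
the centre trivially; elements written as products of disjoint cycles `List.formPerm`).  Three elementary abelian
subgroups `S, T, U` of order `4` (sections over three pairwise complementary totally singular planes of the orthogonal
space `𝔽₂⁴ = G/Z(G)`) satisfy the triple product property (`extraspecial32_tpp_444`, kernel `decide`), and the
subgroup of `Sym(8)` they generate has order exactly `32` (`extraspecial32_closure_card`: the `32`-element product
set `S * (T * U)` contains `1` and is stable under left multiplication by every generator, hence is the generated
subgroup — `closure_eq_of_stable`).  Volume `4·4·4 = 64 = 2·32` (`beta_extraspecial32_ge_twice_order`): the census'
largest ratio `β/|G| = 2` at the smallest order where it occurs in our data.  The sum of the cubes of the character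
degrees of `2^{1+4}_+` is `16 + 64 = 80 > 64` (not a Cohn–Umans beater); kissat finds every larger Neumann-feasible
pattern UNSAT (kit j101793/j102194, DRAT-verified) so `β(2^{1+4}_+) = 64` as a computation; the sibling
`2^{1+4}_− = D₈ ∘ Q₈` has `β = 32 = |G|`.  The lift of this triple to `D₈ × D₈` is `d8_prod_d8_tpp_844`
(D8ProdD8Capacity.lean).  (The identification of the generated subgroup with `2^{1+4}_+` is informal and not used by
any statement: order 32, centre of order 2, exponent 4, 19 involutions.)

Technical note: bounded quantifiers over these sets are decided through `forall_mem_of_decide`, which pins the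
`Finset`-bounded decidability instance (instance search would otherwise pick `Fintype.decidableForallFintype` and
enumerate all `8! = 40320` permutations).
-/

namespace Summit.MatrixMultiplication.OmegaCensus

open Literature.Combinatorics.Additive Finset
open scoped Pointwise

/-- `∀ a ∈ s, p a` from a kernel evaluation of `decide` with the `Finset`-bounded instance pinned. [folklore] -/
theorem forall_mem_of_decide {α : Type*} (s : Finset α) (p : α → Prop) [DecidablePred p]
    (h : @decide (∀ a ∈ s, p a) (@Finset.decidableDforallFinset α s (fun a _ => p a) fun _ _ => inferInstance) =
      true) : ∀ a ∈ s, p a :=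
  of_decide_eq_true h

/-- Stability of a finite set `X` under left multiplication by `A`, from a kernel evaluation of `decide` with the
`Finset`-bounded instances pinned (stated as a β-redex so that the literal sets are elaborated once). [folklore] -/
theorem stable_of_decide {G : Type*} [Mul G] [DecidableEq G] (A X : Finset G)
    (h : @decide (∀ g ∈ A, ∀ x ∈ X, g * x ∈ X) (@Finset.decidableDforallFinset _ A (fun g _ => ∀ x ∈ X, g * x ∈ X)
      fun g _ => @Finset.decidableDforallFinset _ X (fun x _ => g * x ∈ X) fun _ _ => inferInstance) = true) :
    (fun A X : Finset G => ∀ g ∈ A, ∀ x ∈ X, g * x ∈ X) A X :=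
  of_decide_eq_true h

/-- The triple product property from ONE bounded quantifier over the product finset (so that `decide` needs a
single `Finset`-bounded decidability instance). [folklore] -/
theorem tpp_of_forall_product {G : Type*} [Group G] [DecidableEq G] {S T U : Finset G}
    (h : ∀ p ∈ (S ×ˢ S) ×ˢ ((T ×ˢ T) ×ˢ (U ×ˢ U)),
      p.1.1 * p.1.2⁻¹ * (p.2.1.1 * p.2.1.2⁻¹) * (p.2.2.1 * p.2.2.2⁻¹) = 1 →
        p.1.1 = p.1.2 ∧ p.2.1.1 = p.2.1.2 ∧ p.2.2.1 = p.2.2.2) :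
    TripleProductProperty S T U := by
  intro s hs s' hs' t ht t' ht' u hu u' hu'
  exact h ((s, s'), (t, t'), (u, u')) (by simp only [Finset.mem_product]; exact ⟨⟨hs, hs'⟩, ⟨ht, ht'⟩, hu, hu'⟩)

/-- **A `(4,4,4)` TPP triple of `2^{1+4}_+ ≤ Sym(8)`** (kernel `decide`). [folklore] -/
theorem extraspecial32_tpp_444 :
    TripleProductProperty
      ({1,
        List.formPerm [1, 3] * List.formPerm [5, 7],
        List.formPerm [4, 6] * List.formPerm [5, 7],
        List.formPerm [1, 3] * List.formPerm [4, 6]} : Finset (Equiv.Perm (Fin 8)))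
      ({1,
        List.formPerm [0, 3] * List.formPerm [1, 2] * List.formPerm [4, 7] * List.formPerm [5, 6],
        List.formPerm [0, 6] * List.formPerm [1, 7] * List.formPerm [2, 4] * List.formPerm [3, 5],
        List.formPerm [0, 5] * List.formPerm [1, 4] * List.formPerm [2, 7] * List.formPerm [3, 6]} : Finset (Equiv.Perm (Fin 8)))
      ({1,
        List.formPerm [0, 7] * List.formPerm [1, 4] * List.formPerm [2, 5] * List.formPerm [3, 6],
        List.formPerm [0, 1] * List.formPerm [2, 3] * List.formPerm [4, 7] * List.formPerm [5, 6],
        List.formPerm [0, 4] * List.formPerm [1, 7] * List.formPerm [2, 6] * List.formPerm [3, 5]} : Finset (Equiv.Perm (Fin 8))) :=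
  tpp_of_forall_product (forall_mem_of_decide _ _ (by decide +kernel))

/-- The product set `S * (T * U)` has `32` elements (kernel `decide`). [folklore] -/
theorem extraspecial32_product_card :
    (({1,
        List.formPerm [1, 3] * List.formPerm [5, 7],
        List.formPerm [4, 6] * List.formPerm [5, 7],
        List.formPerm [1, 3] * List.formPerm [4, 6]} : Finset (Equiv.Perm (Fin 8))) *
      (({1,
        List.formPerm [0, 3] * List.formPerm [1, 2] * List.formPerm [4, 7] * List.formPerm [5, 6],
        List.formPerm [0, 6] * List.formPerm [1, 7] * List.formPerm [2, 4] * List.formPerm [3, 5],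
        List.formPerm [0, 5] * List.formPerm [1, 4] * List.formPerm [2, 7] * List.formPerm [3, 6]} : Finset (Equiv.Perm (Fin 8))) *
      ({1,
        List.formPerm [0, 7] * List.formPerm [1, 4] * List.formPerm [2, 5] * List.formPerm [3, 6],
        List.formPerm [0, 1] * List.formPerm [2, 3] * List.formPerm [4, 7] * List.formPerm [5, 6],
        List.formPerm [0, 4] * List.formPerm [1, 7] * List.formPerm [2, 6] * List.formPerm [3, 5]} : Finset (Equiv.Perm (Fin 8))))).card = 32 := by
  decide +kernel

/-- `1 ∈ S * (T * U)` (kernel `decide`). [folklore] -/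
theorem extraspecial32_product_one_mem :
    (1 : Equiv.Perm (Fin 8)) ∈
      ({1,
        List.formPerm [1, 3] * List.formPerm [5, 7],
        List.formPerm [4, 6] * List.formPerm [5, 7],
        List.formPerm [1, 3] * List.formPerm [4, 6]} : Finset (Equiv.Perm (Fin 8))) *
      (({1,
        List.formPerm [0, 3] * List.formPerm [1, 2] * List.formPerm [4, 7] * List.formPerm [5, 6],
        List.formPerm [0, 6] * List.formPerm [1, 7] * List.formPerm [2, 4] * List.formPerm [3, 5],
        List.formPerm [0, 5] * List.formPerm [1, 4] * List.formPerm [2, 7] * List.formPerm [3, 6]} : Finset (Equiv.Perm (Fin 8))) *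
      ({1,
        List.formPerm [0, 7] * List.formPerm [1, 4] * List.formPerm [2, 5] * List.formPerm [3, 6],
        List.formPerm [0, 1] * List.formPerm [2, 3] * List.formPerm [4, 7] * List.formPerm [5, 6],
        List.formPerm [0, 4] * List.formPerm [1, 7] * List.formPerm [2, 6] * List.formPerm [3, 5]} : Finset (Equiv.Perm (Fin 8)))) := by
  decide +kernel

/-- `S * (T * U)` is stable under left multiplication by every element of `S ∪ T ∪ U` (kernel `decide`; stated through
a β-redex so that each literal set is elaborated once). [folklore] -/
theorem extraspecial32_product_stable :
    (fun (A X : Finset (Equiv.Perm (Fin 8))) => ∀ g ∈ A, ∀ x ∈ X, g * x ∈ X)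
      (({1,
        List.formPerm [1, 3] * List.formPerm [5, 7],
        List.formPerm [4, 6] * List.formPerm [5, 7],
        List.formPerm [1, 3] * List.formPerm [4, 6]} : Finset (Equiv.Perm (Fin 8))) ∪
      ({1,
        List.formPerm [0, 3] * List.formPerm [1, 2] * List.formPerm [4, 7] * List.formPerm [5, 6],
        List.formPerm [0, 6] * List.formPerm [1, 7] * List.formPerm [2, 4] * List.formPerm [3, 5],
        List.formPerm [0, 5] * List.formPerm [1, 4] * List.formPerm [2, 7] * List.formPerm [3, 6]} : Finset (Equiv.Perm (Fin 8))) ∪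
      ({1,
        List.formPerm [0, 7] * List.formPerm [1, 4] * List.formPerm [2, 5] * List.formPerm [3, 6],
        List.formPerm [0, 1] * List.formPerm [2, 3] * List.formPerm [4, 7] * List.formPerm [5, 6],
        List.formPerm [0, 4] * List.formPerm [1, 7] * List.formPerm [2, 6] * List.formPerm [3, 5]} : Finset (Equiv.Perm (Fin 8))))
      (({1,
        List.formPerm [1, 3] * List.formPerm [5, 7],
        List.formPerm [4, 6] * List.formPerm [5, 7],
        List.formPerm [1, 3] * List.formPerm [4, 6]} : Finset (Equiv.Perm (Fin 8))) *
      (({1,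
        List.formPerm [0, 3] * List.formPerm [1, 2] * List.formPerm [4, 7] * List.formPerm [5, 6],
        List.formPerm [0, 6] * List.formPerm [1, 7] * List.formPerm [2, 4] * List.formPerm [3, 5],
        List.formPerm [0, 5] * List.formPerm [1, 4] * List.formPerm [2, 7] * List.formPerm [3, 6]} : Finset (Equiv.Perm (Fin 8))) *
      ({1,
        List.formPerm [0, 7] * List.formPerm [1, 4] * List.formPerm [2, 5] * List.formPerm [3, 6],
        List.formPerm [0, 1] * List.formPerm [2, 3] * List.formPerm [4, 7] * List.formPerm [5, 6],
        List.formPerm [0, 4] * List.formPerm [1, 7] * List.formPerm [2, 6] * List.formPerm [3, 5]} : Finset (Equiv.Perm (Fin 8))))) :=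
  stable_of_decide _ _ (by decide +kernel)

/-- If a finite set `X ∋ 1` of a group is stable under left multiplication by every element of `A` and consists of
elements of the subgroup generated by `A`, then that subgroup is exactly `X`. [folklore] -/
theorem closure_eq_of_stable {G : Type*} [Group G] [DecidableEq G] (A X : Finset G) (h1 : (1 : G) ∈ X)
    (hstab : ∀ g ∈ A, ∀ x ∈ X, g * x ∈ X) (hX : ∀ x ∈ X, x ∈ Subgroup.closure (A : Set G)) :
    (Subgroup.closure (A : Set G) : Set G) = X := by
  apply Set.Subset.antisymm
  · -- every element of the closure stabilises `X`, hence sends `1 ∈ X` into `X`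
    have key : ∀ k ∈ Subgroup.closure (A : Set G), ∀ x ∈ X, k * x ∈ X := by
      intro k hk
      refine Subgroup.closure_induction (p := fun k _ => ∀ x ∈ X, k * x ∈ X) ?_ ?_ ?_ ?_ hk
      · intro g hg x hx; exact hstab g (Finset.mem_coe.1 hg) x hx
      · intro x hx; simpa using hx
      · intro a b _ _ ha hb x hx; rw [mul_assoc]; exact ha _ (hb x hx)
      · intro a _ ha x hx
        -- left multiplication by `a` maps `X` injectively into `X`, hence onto `X`
        have himg : X.image (a * ·) = X := by
          apply Finset.eq_of_subset_of_card_le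
          · intro y hy; obtain ⟨x, hx, rfl⟩ := Finset.mem_image.1 hy; exact ha x hx
          · rw [Finset.card_image_of_injective _ (mul_right_injective a)]
        rw [← himg] at hx
        obtain ⟨y, hy, hyx⟩ := Finset.mem_image.1 hx
        have : a⁻¹ * x = y := by rw [← hyx]; group
        rw [this]; exact hy
    intro k hk
    simpa using key k hk 1 h1
  · intro x hx; exact hX x (Finset.mem_coe.1 hx)

/-- **The subgroup of `Sym(8)` generated by `S ∪ T ∪ U` has order `32`** (it is `2^{1+4}_+`). [folklore] -/
theorem extraspecial32_closure_card :
    Nat.card (Subgroup.closure ((({1,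
        List.formPerm [1, 3] * List.formPerm [5, 7],
        List.formPerm [4, 6] * List.formPerm [5, 7],
        List.formPerm [1, 3] * List.formPerm [4, 6]} : Finset (Equiv.Perm (Fin 8))) ∪
      ({1,
        List.formPerm [0, 3] * List.formPerm [1, 2] * List.formPerm [4, 7] * List.formPerm [5, 6],
        List.formPerm [0, 6] * List.formPerm [1, 7] * List.formPerm [2, 4] * List.formPerm [3, 5],
        List.formPerm [0, 5] * List.formPerm [1, 4] * List.formPerm [2, 7] * List.formPerm [3, 6]} : Finset (Equiv.Perm (Fin 8))) ∪
      ({1,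
        List.formPerm [0, 7] * List.formPerm [1, 4] * List.formPerm [2, 5] * List.formPerm [3, 6],
        List.formPerm [0, 1] * List.formPerm [2, 3] * List.formPerm [4, 7] * List.formPerm [5, 6],
        List.formPerm [0, 4] * List.formPerm [1, 7] * List.formPerm [2, 6] * List.formPerm [3, 5]} : Finset (Equiv.Perm (Fin 8))) : Finset (Equiv.Perm (Fin 8))) : Set (Equiv.Perm (Fin 8)))) = 32 := by
  have hcard := extraspecial32_product_card
  have h1 := extraspecial32_product_one_mem
  have hstab := extraspecial32_product_stable
  simp only [] at hstab
  have hX : ∀ x ∈ ({1,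
        List.formPerm [1, 3] * List.formPerm [5, 7],
        List.formPerm [4, 6] * List.formPerm [5, 7],
        List.formPerm [1, 3] * List.formPerm [4, 6]} : Finset (Equiv.Perm (Fin 8))) *
      (({1,
        List.formPerm [0, 3] * List.formPerm [1, 2] * List.formPerm [4, 7] * List.formPerm [5, 6],
        List.formPerm [0, 6] * List.formPerm [1, 7] * List.formPerm [2, 4] * List.formPerm [3, 5],
        List.formPerm [0, 5] * List.formPerm [1, 4] * List.formPerm [2, 7] * List.formPerm [3, 6]} : Finset (Equiv.Perm (Fin 8))) *
      ({1,
        List.formPerm [0, 7] * List.formPerm [1, 4] * List.formPerm [2, 5] * List.formPerm [3, 6],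
        List.formPerm [0, 1] * List.formPerm [2, 3] * List.formPerm [4, 7] * List.formPerm [5, 6],
        List.formPerm [0, 4] * List.formPerm [1, 7] * List.formPerm [2, 6] * List.formPerm [3, 5]} : Finset (Equiv.Perm (Fin 8)))),
      x ∈ Subgroup.closure ((({1,
        List.formPerm [1, 3] * List.formPerm [5, 7],
        List.formPerm [4, 6] * List.formPerm [5, 7],
        List.formPerm [1, 3] * List.formPerm [4, 6]} : Finset (Equiv.Perm (Fin 8))) ∪
      ({1,
        List.formPerm [0, 3] * List.formPerm [1, 2] * List.formPerm [4, 7] * List.formPerm [5, 6],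
        List.formPerm [0, 6] * List.formPerm [1, 7] * List.formPerm [2, 4] * List.formPerm [3, 5],
        List.formPerm [0, 5] * List.formPerm [1, 4] * List.formPerm [2, 7] * List.formPerm [3, 6]} : Finset (Equiv.Perm (Fin 8))) ∪
      ({1,
        List.formPerm [0, 7] * List.formPerm [1, 4] * List.formPerm [2, 5] * List.formPerm [3, 6],
        List.formPerm [0, 1] * List.formPerm [2, 3] * List.formPerm [4, 7] * List.formPerm [5, 6],
        List.formPerm [0, 4] * List.formPerm [1, 7] * List.formPerm [2, 6] * List.formPerm [3, 5]} : Finset (Equiv.Perm (Fin 8))) : Finset (Equiv.Perm (Fin 8))) : Set (Equiv.Perm (Fin 8))) := by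
    intro x hx
    obtain ⟨s, hs, y, hy, rfl⟩ := Finset.mem_mul.1 hx
    obtain ⟨t, ht, u, hu, rfl⟩ := Finset.mem_mul.1 hy
    exact Subgroup.mul_mem _ (Subgroup.subset_closure (Finset.mem_coe.2
        (Finset.mem_union_left _ (Finset.mem_union_left _ hs))))
      (Subgroup.mul_mem _ (Subgroup.subset_closure (Finset.mem_coe.2
        (Finset.mem_union_left _ (Finset.mem_union_right _ ht))))
        (Subgroup.subset_closure (Finset.mem_coe.2 (Finset.mem_union_right _ hu))))
  have hset := closure_eq_of_stable _ _ h1 hstab hX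
  have h32 : Nat.card ((Subgroup.closure ((({1,
        List.formPerm [1, 3] * List.formPerm [5, 7],
        List.formPerm [4, 6] * List.formPerm [5, 7],
        List.formPerm [1, 3] * List.formPerm [4, 6]} : Finset (Equiv.Perm (Fin 8))) ∪
      ({1,
        List.formPerm [0, 3] * List.formPerm [1, 2] * List.formPerm [4, 7] * List.formPerm [5, 6],
        List.formPerm [0, 6] * List.formPerm [1, 7] * List.formPerm [2, 4] * List.formPerm [3, 5],
        List.formPerm [0, 5] * List.formPerm [1, 4] * List.formPerm [2, 7] * List.formPerm [3, 6]} : Finset (Equiv.Perm (Fin 8))) ∪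
      ({1,
        List.formPerm [0, 7] * List.formPerm [1, 4] * List.formPerm [2, 5] * List.formPerm [3, 6],
        List.formPerm [0, 1] * List.formPerm [2, 3] * List.formPerm [4, 7] * List.formPerm [5, 6],
        List.formPerm [0, 4] * List.formPerm [1, 7] * List.formPerm [2, 6] * List.formPerm [3, 5]} : Finset (Equiv.Perm (Fin 8))) : Finset (Equiv.Perm (Fin 8))) : Set (Equiv.Perm (Fin 8))) : Subgroup (Equiv.Perm (Fin 8))) :
      Set (Equiv.Perm (Fin 8))) = 32 := by
    rw [hset, Nat.card_coe_set_eq, Set.ncard_coe_finset]; exact hcard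
  simpa using h32

/-- **`β(2^{1+4}_+) ≥ 64 = 2·|G|`**: a subgroup of `Sym(8)` of order `32` containing a TPP triple of volume `64`.
[folklore] -/
theorem beta_extraspecial32_ge_twice_order :
    ∃ K : Subgroup (Equiv.Perm (Fin 8)), Nat.card K = 32 ∧
      ∃ S T U : Finset (Equiv.Perm (Fin 8)), (S : Set (Equiv.Perm (Fin 8))) ⊆ K ∧
        (T : Set (Equiv.Perm (Fin 8))) ⊆ K ∧ (U : Set (Equiv.Perm (Fin 8))) ⊆ K ∧
        TripleProductProperty S T U ∧ S.card * T.card * U.card = 2 * 32 := by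
  refine ⟨_, extraspecial32_closure_card, _, _, _, ?_, ?_, ?_, extraspecial32_tpp_444, by decide +kernel⟩
  · intro x hx
    exact Subgroup.subset_closure (Finset.mem_coe.2 (Finset.mem_union_left _ (Finset.mem_union_left _ hx)))
  · intro x hx
    exact Subgroup.subset_closure (Finset.mem_coe.2 (Finset.mem_union_left _ (Finset.mem_union_right _ hx)))
  · intro x hx
    exact Subgroup.subset_closure (Finset.mem_coe.2 (Finset.mem_union_right _ hx))

end Summit.MatrixMultiplication.OmegaCensus
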